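import Summits.QuantumFields.YangMills.Theorems.BalabanLadderNTMarkovMirror
import HarnessLib

/-!
# Crux `UVSeamRec` (stmt-QuantumFields-20043), lane B: the torus DLR step for bounded MEASURABLE cylinder observables
# with a measurable exterior spectator (infrastructure for the DLR-peeling of large-field product laws)

Helper file (`--supports stmt-QuantumFields-20043`) of the width-lever seat `ym-20043-ceilings-p2` (lane B, gen 6).

WHY.  Lane B's supplier target for the large-field half of (RM) is a PRODUCT LAW for indicators of Bałaban's block-field
events (`PolymerData.largeFieldEvent`) under the Wilson state of an odd torus (the WINDOW CELL LAWS hWCL of p554392).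
The RP-free, divisibility-free road to such a law is DLR PEELING: pull one cube kernel at a time through the torus
state with the other indicators as an exterior spectator, and bound the kernel uniformly in the exterior.  The tree's
torus DLR step (`Literature…wilsonExpectation_toTorusObservable_eq`, its window form
`StubLower.integral_torusLift_eq_integral_kernel`, and the spectator form `MarkovMirror.integral_mul_lift_eq_integral_mul_kerE`)
asks the observable (and the spectator) to be CONTINUOUS; indicators of block-field events are not (the block averaging
`ExpMeanLog.expMeanLogSU` is only `SmallContinuous`).  This file removes the continuity hypothesis: the proof of the
Literature theorem uses continuity of `F` only to produce (strong) measurability, so the same argument runs for bounded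
MEASURABLE cylinder observables.

CONTENTS.  §1 `wilsonExpectation_toTorusObservable_eq_of_measurable` — the Literature theorem with `Continuous F`
replaced by `Measurable F` (proof transcribed, all its lemmas are the tree's); §2 the window form
`integral_torusLift_eq_integral_kernel_of_measurable`; §3 in the `DlrCollarTransfer` letters (`torusE`, `kerE` of a cube
`(c, b)`): the one-cube step `torusE_eq_torusE_kerE_of_measurable` and the SPECTATOR form
`torusE_mul_eq_torusE_mul_kerE_of_measurable` (`E_T[H·F] = E_T[H·kerE_Q(F)]` for bounded measurable cylinders `F` (links
in the window of `Q`) and `H` (no interior link of `Q`), all inside one torus window).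

HONEST FRAMING: folklore probability (Georgii 2011 (4.18); Friedli–Velenik 2017 (6.34)) in the tree's vocabulary;
nothing of E0′, of the seam or the gap; not Clay.
-/

set_option autoImplicit false

noncomputable section

open MeasureTheory Filter Topology Finset
open Literature.Probability.LatticeModels
open Literature.MathematicalPhysics.QuantumFieldTheory (GaugeConfig wilsonMeasure LatticeRep wilsonExpectation Plaquette
  plaquetteHolonomy wilsonAction haarProbability Edge)
open Literature.MathematicalPhysics.QuantumLattice

/-! ## §1 The Literature theorem with a measurable observable -/

namespace Summit.QuantumFields.YangMills.Cruxes.UVSeamRec.DLRPeeling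

section Literature

variable {d N : ℕ} {G : Type*} [Group G] [TopologicalSpace G] [IsTopologicalGroup G]
  [CompactSpace G] [MeasurableSpace G] [BorelSpace G] [SecondCountableTopology G]
  (ρ : G →* Matrix (Fin N) (Fin N) ℂ)

/-- **Torus Wilson states satisfy the local DLR equations of `ymSpecification` — bounded MEASURABLE cylinder
observables.**  Let `F` be a bounded measurable cylinder observable on `ℤ^d` with support `S₀`, and let the torus size
`L` be so large that reduction mod `L` is injective on the base points of `Λ ∪ S₀ ∪ ∂Λ`.  Then the torus Wilson state
gives the same expectation to `F ∘ torusLift` and to `(γ_Λ F) ∘ torusLift`.  The proof of the tree's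
`wilsonExpectation_toTorusObservable_eq` verbatim, with (strong) measurability supplied by `Measurable F` instead of
`Continuous F` (Georgii 2011, proof of Thm. 4.17, step (4.18); Friedli–Velenik 2017, (6.34)). [folklore] -/
theorem wilsonExpectation_toTorusObservable_eq_of_measurable (hρ : Continuous ρ) (β : ℝ) (Λ : Finset (ZdEdge d))
    {F : LGConfig d G → ℝ} (hF : Measurable F) {C : ℝ} (hC : ∀ U, |F U| ≤ C)
    {S₀ : Finset (ZdEdge d)} (hFS : IsCylinder F S₀) {L : ℕ} [NeZero L]
    (hL : Set.InjOn (Torus.proj L)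
      ((Λ ∪ S₀ ∪ (plaquettesTouching Λ).biUnion plaquetteEdges).image Prod.fst : Set (Site d))) :
    wilsonExpectation ρ β (toTorusObservable L F) =
      wilsonExpectation ρ β
        (toTorusObservable L fun η => ∫ U, F U ∂(ymSpecification ρ β Λ η)) := by
  classical
  -- the relevant finite edge set `T` and the injectivity consequences of `hL`
  have hΛT : Λ ⊆ Λ ∪ S₀ ∪ (plaquettesTouching Λ).biUnion plaquetteEdges :=
    (subset_union_left).trans subset_union_left
  have hS₀T : S₀ ⊆ Λ ∪ S₀ ∪ (plaquettesTouching Λ).biUnion plaquetteEdges :=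
    (subset_union_right).trans subset_union_left
  have hPT : (plaquettesTouching Λ).biUnion plaquetteEdges ⊆
      Λ ∪ S₀ ∪ (plaquettesTouching Λ).biUnion plaquetteEdges := subset_union_right
  have hTinj := injOn_torusEdge hL
  have hPinj := injOn_projPlaquette (image_subset_image hPT) hL
  -- near and far parts of the torus action
  set a : GaugeConfig d L G → ℝ := fun V =>
    -β * ∑ q ∈ (plaquettesTouching Λ).image
        (fun p : ZdPlaquette d => ((Torus.proj L p.1, p.2) : Plaquette d L)),
      ((N : ℝ) - (ρ (plaquetteHolonomy V q.1 q.2.1.1 q.2.1.2)).trace.re)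
    with ha_def
  set b : GaugeConfig d L G → ℝ := fun V =>
    -β * ∑ q ∈ ((plaquettesTouching Λ).image
        (fun p : ZdPlaquette d => ((Torus.proj L p.1, p.2) : Plaquette d L)))ᶜ,
      ((N : ℝ) - (ρ (plaquetteHolonomy V q.1 q.2.1.1 q.2.1.2)).trace.re)
    with hb_def
  have hab : ∀ V, -β * wilsonAction ρ V = a V + b V := fun V => by
    simp only [ha_def, hb_def, wilsonAction, ← mul_add,
      Finset.sum_add_sum_compl]
  have ha : ∀ V, a V = -β * wilsonBoundaryAction ρ Λ (torusLift L V) := fun V => by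
    simp only [ha_def, sum_image_proj_plaquetteTerm ρ hPinj]
  have hb : ∀ W V, b ((Λ.image (torusEdge L)).piecewise W V) = b V := fun W V => by
    simp only [hb_def]
    congr 1
    refine Finset.sum_congr rfl fun q hq => ?_
    rw [plaquetteHolonomy_piecewise_of_ne (fun p hp h => (Finset.mem_compl.1 hq)
      (Finset.mem_image.2 ⟨p, hp, h⟩)) W V]
  have hac : Continuous a :=
    continuous_const.mul (continuous_finsetSum _ fun q _ => continuous_plaquetteTerm ρ hρ q)
  have hbc : Continuous b :=
    continuous_const.mul (continuous_finsetSum _ fun q _ => continuous_plaquetteTerm ρ hρ q)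
  obtain ⟨A, hA⟩ := exists_bound_of_continuous hac
  obtain ⟨B, hB⟩ := exists_bound_of_continuous hbc
  have hFt : Measurable fun V : GaugeConfig d L G => F (torusLift L V) :=
    hF.comp (continuous_torusLift L).measurable
  -- transfer of the fibre integrals from `G^Λ` to the torus
  have hτ : Function.Injective fun e : ↥Λ => torusEdge L (e : ZdEdge d) := fun e₁ e₂ h =>
    Subtype.ext (hTinj (hΛT e₁.2) (hΛT e₂.2) h)
  have transfer : ∀ Φ : LGConfig d G → ℝ, Measurable Φ →
      DependsOn Φ ↑(Λ ∪ S₀ ∪ (plaquettesTouching Λ).biUnion plaquetteEdges) →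
      ∀ V : GaugeConfig d L G,
        ∫ ζ, Φ (glueWith Λ ζ (torusLift L V))
            ∂(Measure.pi fun _ : ↥Λ => haarProbability G) =
          ∫ W, Φ (torusLift L ((Λ.image (torusEdge L)).piecewise W V))
            ∂(Measure.pi fun _ : Edge d L =>
              haarProbability G) := by
    intro Φ hΦm hΦT V
    have hm : Measurable fun (W : GaugeConfig d L G) (e : ↥Λ) =>
        W (torusEdge L (e : ZdEdge d)) :=
      measurable_pi_iff.2 fun e => measurable_pi_apply _
    have hc : Measurable fun ζ : ↥Λ → G => Φ (glueWith Λ ζ (torusLift L V)) :=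
      hΦm.comp ((measurable_glueWith_prod Λ).comp (measurable_const.prodMk measurable_id))
    rw [← pi_map_comp_injective (haarProbability G) hτ,
      integral_map hm.aemeasurable hc.aestronglyMeasurable]
    refine congrArg _ (funext fun W => hΦT fun e he => ?_)
    exact (torusLift_piecewise_apply hΛT hTinj W V he).symm
  -- locality of the two fibre integrands
  have hST : DependsOn (wilsonBoundaryAction (G := G) ρ Λ)
      ↑(Λ ∪ S₀ ∪ (plaquettesTouching Λ).biUnion plaquetteEdges) :=
    (isCylinder_wilsonBoundaryAction_holds (G := G) ρ Λ).mono (Finset.coe_subset.2 hPT)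
  have hFT : DependsOn F ↑(Λ ∪ S₀ ∪ (plaquettesTouching Λ).biUnion plaquetteEdges) :=
    hFS.mono (Finset.coe_subset.2 hS₀T)
  have hw : Continuous fun U : LGConfig d G => Real.exp (-β * wilsonBoundaryAction ρ Λ U) :=
    Real.continuous_exp.comp (continuous_const.mul (continuous_wilsonBoundaryAction ρ hρ Λ))
  -- the kernel average of `F` at a periodic boundary condition, computed on the torus
  have key : ∀ V : GaugeConfig d L G,
      ∫ U, F U ∂(ymSpecification ρ β Λ (torusLift L V)) =
        (∫ W, F (torusLift L ((Λ.image (torusEdge L)).piecewise W V)) *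
            Real.exp (a ((Λ.image (torusEdge L)).piecewise W V))
            ∂(Measure.pi fun _ : Edge d L =>
              haarProbability G)) /
          ∫ W, Real.exp (a ((Λ.image (torusEdge L)).piecewise W V))
            ∂(Measure.pi fun _ : Edge d L =>
              haarProbability G) := by
    intro V
    rw [integral_ymSpecification ρ hρ β Λ hF,
      transfer (fun U => F U * Real.exp (-β * wilsonBoundaryAction ρ Λ U)) (hF.mul hw.measurable)
        (fun x y h => by simp only [hFT h, hST h]),
      transfer (fun U => Real.exp (-β * wilsonBoundaryAction ρ Λ U)) hw.measurable
        (fun x y h => by simp only [hST h])]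
    simp only [ha]
  -- conclude with the finite-volume DLR identity on the torus
  rw [wilsonExpectation_eq_toReal_mul_integral ρ hρ β,
    wilsonExpectation_eq_toReal_mul_integral ρ hρ β]
  congr 1
  simp only [toTorusObservable_apply, key, hab]
  exact integral_exp_mul_eq_integral_exp_mul_condAvg (haarProbability G)
    (Λ.image (torusEdge L)) (F := fun V => F (torusLift L V))
    (NF := fun V => ∫ W, F (torusLift L ((Λ.image (torusEdge L)).piecewise W V)) *
      Real.exp (a ((Λ.image (torusEdge L)).piecewise W V))
        ∂(Measure.pi fun _ : Edge d L => haarProbability G))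
    (N1 := fun V => ∫ W, Real.exp (a ((Λ.image (torusEdge L)).piecewise W V))
        ∂(Measure.pi fun _ : Edge d L => haarProbability G))
    hFt hac.measurable hbc.measurable (fun V => hC _) hA hB hb (fun V => rfl)
    (fun V => rfl)

/-! ## §2 Window form -/

open Summit.QuantumFields.YangMills.Theorems.OSLegsFromFemtoAndGap.StubLower
  (injOn_torusProj_of_window exists_near_of_mem_plaquetteEdges_touching)

/-- **Torus DLR step, window form, bounded MEASURABLE cylinder observable**: if every base point of `Λ ∪ supp F`
lies, with margin one, in a coordinate window of width `T`, the torus Wilson state of side `T` gives the same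
expectation to `F ∘ torusLift` and to `(γ_Λ F) ∘ torusLift` (the continuous twin is
`StubLower.integral_torusLift_eq_integral_kernel`). [folklore] -/
theorem integral_torusLift_eq_integral_kernel_of_measurable (hρ : Continuous ρ) (β : ℝ)
    (Λ : Finset (ZdEdge d)) {F : LGConfig d G → ℝ}
    (hF : Measurable F) {C : ℝ} (hC : ∀ U, |F U| ≤ C)
    {S₀ : Finset (ZdEdge d)} (hFS : IsCylinder F S₀)
    (T : ℕ) [NeZero T] (lo : Fin d → ℤ)
    (hwin : ∀ e ∈ Λ ∪ S₀, ∀ j, lo j + 1 ≤ e.1 j ∧ e.1 j + 2 ≤ lo j + T) :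
    ∫ U, F (torusLift T U) ∂(wilsonMeasure (d := d) (L := T) ρ β) =
      ∫ U, (∫ V, F V ∂(ymSpecification ρ β Λ (torusLift T U)))
        ∂(wilsonMeasure (d := d) (L := T) ρ β) := by
  have h := wilsonExpectation_toTorusObservable_eq_of_measurable ρ hρ β Λ hF hC hFS (L := T) ?_
  · simpa only [wilsonExpectation, toTorusObservable, Function.comp_def] using h
  refine injOn_torusProj_of_window T lo fun z hz j => ?_
  obtain ⟨e, he, rfl⟩ := Finset.mem_image.1 (Finset.mem_coe.1 hz)
  rcases Finset.mem_union.1 he with he1 | he2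
  · have := hwin e he1 j
    constructor <;> linarith
  · obtain ⟨e', he'Λ, hnear⟩ := exists_near_of_mem_plaquetteEdges_touching he2
    have := hwin e' (Finset.mem_union_left _ he'Λ) j
    have h' := hnear j
    constructor <;> linarith

end Literature

/-! ## §3 In the `DlrCollarTransfer` letters: cube kernels, one-cube step and spectator form -/

section Cube

open Summit.QuantumFields.YangMills.Cruxes.OSLegsFromFemtoAndGap.DlrCollarTransfer
open Summit.QuantumFields.YangMills.Cruxes.NT.MarkovMirror (cubeEdges_fst_window)
open Summit.QuantumFields.YangMills.Cruxes.OSLegsFromFemtoAndGap.DlrCollarTransfer.StubLower (isCylinder_mul)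

variable (G : Type) [Group G] [TopologicalSpace G] [IsTopologicalGroup G] [CompactSpace G]
  [MeasurableSpace G] [BorelSpace G] (r : LatticeRep G)

/-- **One-cube torus DLR step, bounded MEASURABLE observable**: `E_T[F] = E_T[kerE_Q(F)]` for the cube `Q = (c, b)`
inside the torus window (`lo j + 1 ≤ c j`, `c j + b + 2 ≤ lo j + T`) and a bounded measurable cylinder observable `F`
whose links are based in the window `[c, c + b]`. [folklore] -/
theorem integral_lift_eq_integral_kerE_of_measurable (β : ℝ) (c : Fin 4 → ℤ) (b T : ℕ) [NeZero T] (lo : Fin 4 → ℤ)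
    (hc : ∀ j, lo j + 1 ≤ c j ∧ c j + (b : ℤ) + 2 ≤ lo j + T)
    {F : LGConfig 4 G → ℝ} (hF : Measurable F) {MF : ℝ} (hMF : ∀ U, |F U| ≤ MF)
    {SF : Finset (Literature.MathematicalPhysics.QuantumLattice.ZdEdge 4)} (hFS : IsCylinder F SF)
    (hSF : ∀ e ∈ SF, ∀ j, c j ≤ e.1 j ∧ e.1 j ≤ c j + b) :
    ∫ U, F (torusLift T U) ∂(wilsonMeasure (d := 4) (L := T) r.ρ β) =
      ∫ U, kerE G r β c b (torusLift T U) F ∂(wilsonMeasure (d := 4) (L := T) r.ρ β) := by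
  haveI := r.secondCountableTopology
  have hwin : ∀ e ∈ cubeEdges c b ∪ SF, ∀ j, lo j + 1 ≤ e.1 j ∧ e.1 j + 2 ≤ lo j + T := by
    intro e he j
    have hcj := hc j
    rcases Finset.mem_union.1 he with h1 | h2
    · have := cubeEdges_fst_window h1 j
      constructor <;> linarith [this.1, this.2]
    · have := hSF e h2 j
      constructor <;> linarith [this.1, this.2]
  unfold kerE
  exact integral_torusLift_eq_integral_kernel_of_measurable r.ρ r.continuous β (cubeEdges c b) hF hMF hFS T lo hwin

/-- **One-sided DLR step with a MEASURABLE exterior spectator.**  Cube `Q = (c, b)` inside the torus window; `F` a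
bounded measurable cylinder observable with links based in `[c, c + b]`; `H` a bounded measurable cylinder observable
reading NO interior link of `Q`, supported inside the torus window.  Then on the torus of side `T`
`∫ H(lift U) · F(lift U) dμ_T = ∫ H(lift U) · kerE_Q^{lift U}(F) dμ_T` (the continuous twin is
`MarkovMirror.integral_mul_lift_eq_integral_mul_kerE`): the torus DLR step for the product `H · F` followed by
properness of the kernel (`integral_ymSpecification_cyl_mul`). [folklore] -/
theorem integral_mul_lift_eq_integral_mul_kerE_of_measurable (β : ℝ) (c : Fin 4 → ℤ) (b T : ℕ) [NeZero T]
    (lo : Fin 4 → ℤ) (hc : ∀ j, lo j + 1 ≤ c j ∧ c j + (b : ℤ) + 2 ≤ lo j + T)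
    {F H : LGConfig 4 G → ℝ} (hF : Measurable F) (hH : Measurable H) {MF MH : ℝ}
    (hMF : ∀ U, |F U| ≤ MF) (hMH : ∀ U, |H U| ≤ MH)
    {SF SH : Finset (Literature.MathematicalPhysics.QuantumLattice.ZdEdge 4)}
    (hFS : IsCylinder F SF) (hHS : IsCylinder H SH)
    (hSF : ∀ e ∈ SF, ∀ j, c j ≤ e.1 j ∧ e.1 j ≤ c j + b)
    (hSHoff : ∀ e ∈ SH, e ∉ cubeEdges c b)
    (hSHwin : ∀ e ∈ SH, ∀ j, lo j + 1 ≤ e.1 j ∧ e.1 j + 2 ≤ lo j + T) :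
    ∫ U, H (torusLift T U) * F (torusLift T U) ∂(wilsonMeasure (d := 4) (L := T) r.ρ β) =
      ∫ U, H (torusLift T U) * kerE G r β c b (torusLift T U) F ∂(wilsonMeasure (d := 4) (L := T) r.ρ β) := by
  haveI := r.secondCountableTopology
  have hHF : Measurable fun U => H U * F U := hH.mul hF
  have hHFb : ∀ U, |H U * F U| ≤ MH * MF := fun U => by
    rw [abs_mul]
    exact mul_le_mul (hMH U) (hMF U) (abs_nonneg _) ((abs_nonneg _).trans (hMH U))
  have hwin : ∀ e ∈ cubeEdges c b ∪ (SH ∪ SF), ∀ j, lo j + 1 ≤ e.1 j ∧ e.1 j + 2 ≤ lo j + T := by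
    intro e he j
    have hcj := hc j
    rcases Finset.mem_union.1 he with h1 | h2
    · have := cubeEdges_fst_window h1 j
      constructor <;> linarith [this.1, this.2]
    · rcases Finset.mem_union.1 h2 with hH' | hF'
      · exact hSHwin e hH' j
      · have := hSF e hF' j
        constructor <;> linarith [this.1, this.2]
  have key := integral_torusLift_eq_integral_kernel_of_measurable r.ρ r.continuous β (cubeEdges c b) hHF hHFb
    (isCylinder_mul hHS hFS) T lo hwin
  rw [key]
  refine integral_congr_ae (ae_of_all _ fun U => ?_)
  show ∫ V, H V * F V ∂(ymSpecification (d := 4) r.ρ β (cubeEdges c b) (torusLift T U)) = _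
  unfold kerE
  exact integral_ymSpecification_cyl_mul r.ρ r.continuous β _ hF hH hHS hSHoff _

/-- **The same two identities as identities of torus means** (`torusE` of the torus of side `2L+1`): one-cube step
`E_T[kerE_Q(F)] = E_T[F]` for a bounded measurable cylinder `F` with links in `[c, c+b]`, cube inside the torus
(`−L + 1 ≤ c j`, `c j + b + 2 ≤ L + 1`). [folklore] -/
theorem torusE_kerE_of_measurable (β : ℝ) (c : Fin 4 → ℤ) (b L : ℕ)
    (hc : ∀ j, -(L : ℤ) + 1 ≤ c j ∧ c j + (b : ℤ) + 2 ≤ (L : ℤ) + 1)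
    {F : LGConfig 4 G → ℝ} (hF : Measurable F) {MF : ℝ} (hMF : ∀ U, |F U| ≤ MF)
    {SF : Finset (Literature.MathematicalPhysics.QuantumLattice.ZdEdge 4)} (hFS : IsCylinder F SF)
    (hSF : ∀ e ∈ SF, ∀ j, c j ≤ e.1 j ∧ e.1 j ≤ c j + b) :
    torusE G r β L (fun η => kerE G r β c b η F) = torusE G r β L F := by
  have hc' : ∀ j, (fun _ : Fin 4 => -(L : ℤ)) j + 1 ≤ c j ∧
      c j + (b : ℤ) + 2 ≤ (fun _ : Fin 4 => -(L : ℤ)) j + (2 * L + 1 : ℕ) := fun j => by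
    have := hc j; push_cast; constructor <;> linarith [this.1, this.2]
  unfold torusE
  exact (integral_lift_eq_integral_kerE_of_measurable G r β c b (2 * L + 1) (fun _ => -(L : ℤ)) hc' hF hMF hFS hSF).symm

/-- **Spectator form as an identity of torus means**: `E_T[H · F] = E_T[H · kerE_Q(F)]` for bounded measurable
cylinders `F` (links in `[c, c+b]`) and `H` (no interior link of `Q`, links based in `[−L+1, L−1]`), cube inside
the torus of side `2L+1`. [folklore] -/
theorem torusE_mul_eq_torusE_mul_kerE_of_measurable (β : ℝ) (c : Fin 4 → ℤ) (b L : ℕ)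
    (hc : ∀ j, -(L : ℤ) + 1 ≤ c j ∧ c j + (b : ℤ) + 2 ≤ (L : ℤ) + 1)
    {F H : LGConfig 4 G → ℝ} (hF : Measurable F) (hH : Measurable H) {MF MH : ℝ}
    (hMF : ∀ U, |F U| ≤ MF) (hMH : ∀ U, |H U| ≤ MH)
    {SF SH : Finset (Literature.MathematicalPhysics.QuantumLattice.ZdEdge 4)}
    (hFS : IsCylinder F SF) (hHS : IsCylinder H SH)
    (hSF : ∀ e ∈ SF, ∀ j, c j ≤ e.1 j ∧ e.1 j ≤ c j + b)
    (hSHoff : ∀ e ∈ SH, e ∉ cubeEdges c b)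
    (hSHwin : ∀ e ∈ SH, ∀ j, -(L : ℤ) + 1 ≤ e.1 j ∧ e.1 j ≤ (L : ℤ) - 1) :
    torusE G r β L (fun U => H U * F U) = torusE G r β L (fun η => H η * kerE G r β c b η F) := by
  have hc' : ∀ j, (fun _ : Fin 4 => -(L : ℤ)) j + 1 ≤ c j ∧
      c j + (b : ℤ) + 2 ≤ (fun _ : Fin 4 => -(L : ℤ)) j + (2 * L + 1 : ℕ) := fun j => by
    have := hc j; push_cast; constructor <;> linarith [this.1, this.2]
  have hSHwin' : ∀ e ∈ SH, ∀ j, (fun _ : Fin 4 => -(L : ℤ)) j + 1 ≤ e.1 j ∧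
      e.1 j + 2 ≤ (fun _ : Fin 4 => -(L : ℤ)) j + (2 * L + 1 : ℕ) := fun e he j => by
    have := hSHwin e he j; push_cast; constructor <;> linarith [this.1, this.2]
  unfold torusE
  exact integral_mul_lift_eq_integral_mul_kerE_of_measurable G r β c b (2 * L + 1) (fun _ => -(L : ℤ)) hc'
    hF hH hMF hMH hFS hHS hSF hSHoff hSHwin'

end Cube

end Summit.QuantumFields.YangMills.Cruxes.UVSeamRec.DLRPeeling

end
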